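import Summits.QuantumFields.GaugeBoot.LoopEquationInstances
import Summits.QuantumFields.GaugeBoot.OrbitAverages
import Literature.MathematicalPhysics.QuantumFieldTheory.UnitaryCayleyChart
import HarnessLib

/-!
# Gauge-boot: the PLAQUETTE–GRADIENT IDENTITY — the loop equation summed over the plaquettes through an
# edge, in closed form (large-`N` supplement 18, part 4a; the equipartition bound is part 4b)

HONEST FRAMING (cell `pub-gaugeboot`, page 1 of every file): certified bounds on lattice
expectations at STATED coupling, gauge group, dimension and torus size; NOT a mass gap, NOT a
continuum limit, NOT a string tension, NOT large `N`; NOT Yang–Mills-summit-bearing (barriers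
`FixedCouplingUltralocality`, `PerturbativeInvisibility`).  Pointwise matrix algebra and one loop-equation
instance; no number of CERTIFIED.md is certified here.

## Content

Summing the lane's single-link loop equation (`LoopEquation.loopEquation_of_sdPair`, task L1) over the
`2(d−1)` plaquette words `P̃_{ν,ε}` through an edge `e = (x, μ)`, each taken as the MARKED word, produces — with
`M = Σ_{ν,ε} ρ(hol P̃_{ν,ε})` (`plaqSum`), `T = tr M`, `A = M − Mᴴ`, weight `s` (`1` for `SU(N)`, `0` for `U(N)`) —

  `(N − s/N)·E[T] + (β/2)·E[tr(M²) − tr(M Mᴴ) − (s/N)·T·(T − T̄)] = 0`,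

and `Re(tr M² − tr MMᴴ − (s/N)T(T − T̄)) = −‖A‖²_F/2 + (2s/N)(Im T)²`: one-link integration by parts with the
derivative of the action as test function — the Laplacian of the action against its squared gradient
(for one `U(1)` plaquette: `⟨cos θ⟩_β = β⟨sin²θ⟩_β`).  This file supplies the pieces:

* `sum_splitTerm_plaqWord`, ★ `loopEquation_plaqWord` — the loop equation with the marked word a plaquette
  through the edge, EITHER orientation (`L ≥ 2`; the `+` case is the lane's `loopEquation_plaquette`);
* ★★ `sum_plaqTerm_eq`, `sum_sum_plaqTerm_eq` — the plaquette terms summed over the plaquettes through the edge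
  in closed form `tr(VM) − tr(VMᴴ) − (s/N)·tr V·(T − T̄)`, and the double sum `tr M² − tr MMᴴ − (s/N)T(T − T̄)`;
* ★★ `re_quadratic_eq` — its real part `= −‖M − Mᴴ‖²/2 + (2s/N)(Im tr M)²`;
* ★★ `norm_sq_plaqSum_sub_star_le` — `‖M − Mᴴ‖²/2 ≤ 8(d−1)·Σ_{ν,ε}(N − Re tr ρ(hol P̃_{ν,ε}))`
  (`‖V − Vᴴ‖ ≤ 2‖1 − V‖`, Cauchy–Schwarz, `‖1 − V‖² = 2(N − Re tr V)`);
* `re_trace_plaqWord_true/false`, `wordHolonomy_plaqWord_false` — both orientations carry `N·u_P` of a lattice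
  plaquette (the `−` word through `(y + e_ν, μ)` is `U(y,ν)⁻¹·U_{y;μν}⁻¹·U(y,ν)`).

[folklore] (equipartition / virial identity for the Wilson action.)
-/
noncomputable section

open MeasureTheory Filter Topology NormedSpace
open scoped Matrix.Norms.Frobenius Matrix
open Literature.MathematicalPhysics.QuantumFieldTheory
open Summit.QuantumFields.YangMills.Cruxes.CurvatureAmnesia.WardDefect.SchwingerDyson

namespace Summit.QuantumFields.GaugeBoot

namespace Equipartition

variable {d L N : ℕ} {G : Type} [Group G] {ρ : G →* Matrix (Fin N) (Fin N) ℂ}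

/-! ## The loop equation with a plaquette through the edge as the marked word -/

section Split

/-- On a torus with `L ≥ 2` a negative unit shift moves every site. [folklore] -/
theorem sub_single_ne_self [NeZero L] (hL : (1 : ZMod L) ≠ 0) (x : Site d L) (i : Fin d) :
    x - Pi.single i 1 ≠ x := by
  intro h
  have h' := congrFun h i
  simp at h'
  exact hL h'

variable (ρ) in
/-- **Split terms of the re-oriented plaquette words** `P̃_{ν,ε}` (`ν ≠ μ`, `L ≥ 2`) for the edge `(x, μ)`: only
the first letter traverses the edge, contributing `(N − s/N)·tr ρ(hol P̃)`. [folklore] -/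
theorem sum_splitTerm_plaqWord [NeZero L] (hL : (1 : ZMod L) ≠ 0) (s : ℂ) (x : Site d L) {μ ν : Fin d}
    (hμν : μ ≠ ν) (U : GaugeConfig d L G) (ε : Bool) :
    ∑ k ∈ Finset.range (plaqWord μ ν ε).length, splitTerm ρ s x μ U (plaqWord μ ν ε) k =
      ((N : ℂ) - s / N) * (ρ (wordHolonomy U x (plaqWord μ ν ε))).trace := by
  cases ε with
  | true => simpa using sum_splitTerm_plaquette ρ hL s x hμν U
  | false =>
    have hν : x - Pi.single ν 1 ≠ x := sub_single_ne_self hL x ν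
    have hlen : (plaqWord μ ν false).length = 4 := rfl
    rw [hlen]
    simp only [Finset.sum_range_succ, Finset.sum_range_zero, zero_add]
    have h0 : splitTerm ρ s x μ U (plaqWord μ ν false) 0 =
        ((N : ℂ) - s / N) * (ρ (wordHolonomy U x (plaqWord μ ν false))).trace := by
      unfold splitTerm
      simp only [plaqWord_false, List.getElem?_cons_zero, Word.siteAt_zero, Step.edge_fwd, if_true, Step.isFwd_fwd,
        List.take_zero, wordHolonomy_nil, map_one, Matrix.trace_one, Fintype.card_fin, List.drop_zero]
      ring
    have h1 : splitTerm ρ s x μ U (plaqWord μ ν false) 1 = 0 := by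
      unfold splitTerm
      simp [Word.siteAt, Word.endpoint, hμν.symm]
    have h2 : splitTerm ρ s x μ U (plaqWord μ ν false) 2 = 0 := by
      unfold splitTerm
      have e : x.shift μ - Pi.single ν 1 - Pi.single μ 1 = x - Pi.single ν 1 := by
        simp only [Site.shift]; abel
      simp [Word.siteAt, Word.endpoint, e, hν]
    have h3 : splitTerm ρ s x μ U (plaqWord μ ν false) 3 = 0 := by
      unfold splitTerm
      simp [Word.siteAt, Word.endpoint, hμν.symm]
    rw [h0, h1, h2, h3]
    ring

variable [TopologicalSpace G] [IsTopologicalGroup G] [CompactSpace G] [MeasurableSpace G] [BorelSpace G]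
  (r : LatticeRep G)

/-- **The loop equation with the marked word a plaquette through the edge** (either orientation, `L ≥ 2`):
`(N − s/N)·E[tr ρ(hol P̃_{ν,ε})] + (β/2)·Σ_{ν'≠μ,ε'} E[plaqTerm_{ν',ε'}(P̃_{ν,ε})] = 0`. [folklore] -/
theorem loopEquation_plaqWord [NeZero L] (hL : (1 : ZMod L) ≠ 0) (β : ℝ) (x : Site d L) {μ ν : Fin d}
    (hμν : μ ≠ ν) (ε : Bool) (s : ℂ) (hP : ∀ i j : Fin r.N, SDPair r β x μ x (plaqWord μ ν ε) (unitDir s i j)) :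
    ((r.N : ℂ) - s / r.N) * ∫ U, (r.ρ (wordHolonomy U x (plaqWord μ ν ε))).trace
        ∂(wilsonMeasure (d := d) (L := L) r.ρ β) +
      (β / 2 : ℂ) * ∑ ν' ∈ Finset.univ.erase μ, ∑ ε' : Bool,
        ∫ U, plaqTerm r.ρ s x μ U (plaqWord μ ν ε) ν' ε' ∂(wilsonMeasure (d := d) (L := L) r.ρ β) = 0 := by
  have h := loopEquation_of_sdPair r β x μ s (plaqWord μ ν ε) (endpoint_plaqWord x μ ν ε) hP
  rw [← integral_finsetSum _ fun k _ => integrable_of_continuous r β (continuous_splitTerm r s x μ _ k)] at h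
  simp_rw [sum_splitTerm_plaqWord r.ρ hL s x hμν _ ε] at h
  rwa [integral_const_mul] at h

end Split

/-! ## The summed plaquette terms in closed form -/

section Algebra

variable (ρ) in
/-- The sum `M = Σ_{ν≠μ,ε} ρ(hol P̃_{ν,ε})` of the holonomy matrices of the `2(d−1)` re-oriented plaquette words
through the edge `(x, μ)`. [folklore] -/
def plaqSum (x : Site d L) (μ : Fin d) (U : GaugeConfig d L G) : Matrix (Fin N) (Fin N) ℂ :=
  ∑ ν ∈ Finset.univ.erase μ, ∑ ε : Bool, ρ (wordHolonomy U x (plaqWord μ ν ε))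

/-- The reversed plaquette word carries the adjoint matrix (a unitary-valued representation sends inverses to
adjoints — the tree's `FiniteTemperature.rep_inv_eq_star`, inlined). [folklore] -/
theorem map_wordHolonomy_plaqWord_reverse (hρ : ∀ g, ρ g ∈ Matrix.unitaryGroup (Fin N) ℂ) (U : GaugeConfig d L G)
    (x : Site d L) (μ ν : Fin d) (ε : Bool) :
    ρ (wordHolonomy U x (plaqWord μ ν ε).reverse) = star (ρ (wordHolonomy U x (plaqWord μ ν ε))) := by
  have h := wordHolonomy_reverse U x (plaqWord μ ν ε)
  rw [endpoint_plaqWord] at h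
  rw [h]
  set g := wordHolonomy U x (plaqWord μ ν ε)
  have hu : ρ g * star (ρ g) = 1 := Matrix.mem_unitaryGroup_iff.1 (hρ g)
  have h1 : ρ g⁻¹ * ρ g = 1 := by rw [← map_mul, inv_mul_cancel, map_one]
  calc ρ g⁻¹ = ρ g⁻¹ * (ρ g * star (ρ g)) := by rw [hu, mul_one]
    _ = star (ρ g) := by rw [← mul_assoc, h1, one_mul]

/-- ★★ **The plaquette terms of a closed marked word, summed over the plaquettes through the edge, in closed form**:
`Σ_{ν'≠μ,ε'} plaqTerm_{ν',ε'}(w) = tr(V·M) − tr(V·Mᴴ) − (s/N)·tr V·(tr M − conj tr M)` with `V = ρ(hol w)`,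
`M = plaqSum` (unitary `ρ`). [folklore] -/
theorem sum_plaqTerm_eq (hρ : ∀ g, ρ g ∈ Matrix.unitaryGroup (Fin N) ℂ) (s : ℂ) (x : Site d L) (μ : Fin d)
    (U : GaugeConfig d L G) (w : Word d) (hw : Word.endpoint x w = x) :
    ∑ ν' ∈ Finset.univ.erase μ, ∑ ε' : Bool, plaqTerm ρ s x μ U w ν' ε' =
      (ρ (wordHolonomy U x w) * plaqSum ρ x μ U).trace - (ρ (wordHolonomy U x w) * star (plaqSum ρ x μ U)).trace -
        (s / N) * ((ρ (wordHolonomy U x w)).trace * ((plaqSum ρ x μ U).trace - star (plaqSum ρ x μ U).trace)) := by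
  have happ : ∀ ν' ε', ρ (wordHolonomy U x (w ++ plaqWord μ ν' ε')) =
      ρ (wordHolonomy U x w) * ρ (wordHolonomy U x (plaqWord μ ν' ε')) := fun ν' ε' => by
    rw [wordHolonomy_append_closed U x w _ hw, map_mul]
  have hrev : ∀ ν' ε', ρ (wordHolonomy U x (w ++ (plaqWord μ ν' ε').reverse)) =
      ρ (wordHolonomy U x w) * star (ρ (wordHolonomy U x (plaqWord μ ν' ε'))) := fun ν' ε' => by
    rw [wordHolonomy_append_closed U x w _ hw, map_mul, map_wordHolonomy_plaqWord_reverse hρ]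
  have hrev1 : ∀ ν' ε', ρ (wordHolonomy U x (plaqWord μ ν' ε').reverse) =
      star (ρ (wordHolonomy U x (plaqWord μ ν' ε'))) := fun ν' ε' => map_wordHolonomy_plaqWord_reverse hρ U x μ ν' ε'
  have hts : ∀ A : Matrix (Fin N) (Fin N) ℂ, (star A).trace = star A.trace := fun A => by
    rw [Matrix.star_eq_conjTranspose, Matrix.trace_conjTranspose]
  simp only [plaqTerm, happ, hrev, hrev1, hts, plaqSum, Finset.mul_sum, Matrix.trace_sum, star_sum,
    Finset.sum_sub_distrib, mul_sub]

/-- **The double plaquette sum in closed form**: summing also over the marked plaquette word,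
`Σ_{ν,ε} Σ_{ν',ε'} plaqTerm_{ν',ε'}(P̃_{ν,ε}) = tr(M²) − tr(M Mᴴ) − (s/N)·tr M·(tr M − conj tr M)`. [folklore] -/
theorem sum_sum_plaqTerm_eq (hρ : ∀ g, ρ g ∈ Matrix.unitaryGroup (Fin N) ℂ) (s : ℂ) (x : Site d L) (μ : Fin d)
    (U : GaugeConfig d L G) :
    ∑ ν ∈ Finset.univ.erase μ, ∑ ε : Bool, ∑ ν' ∈ Finset.univ.erase μ, ∑ ε' : Bool,
        plaqTerm ρ s x μ U (plaqWord μ ν ε) ν' ε' =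
      (plaqSum ρ x μ U * plaqSum ρ x μ U).trace - (plaqSum ρ x μ U * star (plaqSum ρ x μ U)).trace -
        (s / N) * ((plaqSum ρ x μ U).trace * ((plaqSum ρ x μ U).trace - star (plaqSum ρ x μ U).trace)) := by
  simp only [sum_plaqTerm_eq hρ s x μ U _ (endpoint_plaqWord x μ _ _)]
  set M := plaqSum ρ x μ U with hM
  have hsum : ∑ ν ∈ Finset.univ.erase μ, ∑ ε : Bool, ρ (wordHolonomy U x (plaqWord μ ν ε)) = M := rfl
  simp only [Finset.sum_sub_distrib, ← Matrix.trace_sum, ← Finset.sum_mul, hsum, ← Finset.mul_sum]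

/-! ## The real part: minus half a squared Hilbert–Schmidt norm, plus a non-negative double-trace term -/

/-- ★ **The plaquette–gradient identity, pointwise part**: for every matrix `M` and real `s`,
`Re(tr M² − tr MMᴴ − (s/N) tr M (tr M − conj tr M)) = −‖M − Mᴴ‖²/2 + (2s/N)(Im tr M)²`. [folklore] -/
theorem re_quadratic_eq (M : Matrix (Fin N) (Fin N) ℂ) (s : ℝ) :
    ((M * M).trace - (M * star M).trace - ((s : ℂ) / N) * (M.trace * (M.trace - star M.trace))).re =
      -‖M - star M‖ ^ 2 / 2 + 2 * s / N * (M.trace.im) ^ 2 := by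
  have hA : ‖M - star M‖ ^ 2 = 2 * (M * star M).trace.re - 2 * (M * M).trace.re := by
    rw [Matrix.frobenius_norm_sq_eq_re_trace, Matrix.conjTranspose_sub, Matrix.star_eq_conjTranspose,
      Matrix.conjTranspose_conjTranspose, Matrix.sub_mul, Matrix.mul_sub, Matrix.mul_sub]
    have h1 : (Mᴴ * Mᴴ).trace = star ((M * M).trace) := by
      rw [← Matrix.conjTranspose_mul, Matrix.trace_conjTranspose]
    have h2 : (Mᴴ * M).trace = (M * Mᴴ).trace := Matrix.trace_mul_comm _ _
    simp only [Matrix.trace_sub, map_sub, h1, h2, RCLike.star_def, RCLike.conj_re]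
    change (M * Mᴴ).trace.re - (M * M).trace.re - ((M * M).trace.re - (M * Mᴴ).trace.re) = _
    ring
  rw [Matrix.star_eq_conjTranspose] at hA ⊢
  have hT : (M.trace * (M.trace - star M.trace)).re = -2 * M.trace.im ^ 2 := by
    rw [Complex.star_def, Complex.mul_re, Complex.sub_re, Complex.sub_im, Complex.conj_re, Complex.conj_im]
    ring
  have hsN : (((s : ℂ) / N) * (M.trace * (M.trace - star M.trace))).re = s / N * (-2 * M.trace.im ^ 2) := by
    rw [Complex.mul_re, hT]
    have hre : ((s : ℂ) / N).re = s / N := by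
      rw [show ((s : ℂ) / N) = ((s / N : ℝ) : ℂ) by push_cast; ring]
      exact Complex.ofReal_re _
    have him : ((s : ℂ) / N).im = 0 := by
      rw [show ((s : ℂ) / N) = ((s / N : ℝ) : ℂ) by push_cast; ring]
      exact Complex.ofReal_im _
    rw [hre, him, zero_mul, sub_zero]
  rw [Complex.sub_re, Complex.sub_re, hsN, hA]
  ring

/-- For a unitary `V`: `‖V − Vᴴ‖ ≤ 2‖1 − V‖` (`V − Vᴴ = (V − 1) + (1 − V)ᴴ`). [folklore] -/
theorem norm_sub_star_le (V : Matrix (Fin N) (Fin N) ℂ) :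
    ‖V - star V‖ ≤ 2 * ‖(1 : Matrix (Fin N) (Fin N) ℂ) - V‖ := by
  have e : V - star V = -((1 : Matrix (Fin N) (Fin N) ℂ) - V) + star ((1 : Matrix (Fin N) (Fin N) ℂ) - V) := by
    rw [star_sub, star_one]; abel
  rw [e]
  calc ‖-((1 : Matrix (Fin N) (Fin N) ℂ) - V) + star ((1 : Matrix (Fin N) (Fin N) ℂ) - V)‖
      ≤ ‖-((1 : Matrix (Fin N) (Fin N) ℂ) - V)‖ + ‖star ((1 : Matrix (Fin N) (Fin N) ℂ) - V)‖ := norm_add_le _ _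
    _ = 2 * ‖(1 : Matrix (Fin N) (Fin N) ℂ) - V‖ := by
        rw [norm_neg, Matrix.star_eq_conjTranspose, Matrix.frobenius_norm_conjTranspose]; ring

/-- Cauchy–Schwarz for the double plaquette index: `(Σ_{ν≠μ} Σ_ε a)² ≤ 2(d−1)·Σ_{ν≠μ} Σ_ε a²`. [folklore] -/
theorem sq_sum_sum_le (μ : Fin d) (a : Fin d → Bool → ℝ) :
    (∑ ν ∈ Finset.univ.erase μ, ∑ ε : Bool, a ν ε) ^ 2 ≤
      2 * ((d : ℝ) - 1) * ∑ ν ∈ Finset.univ.erase μ, ∑ ε : Bool, a ν ε ^ 2 := by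
  have h1 := sq_sum_le_card_mul_sum_sq (s := Finset.univ.erase μ) (f := fun ν => ∑ ε : Bool, a ν ε)
  have hcard : ((Finset.univ.erase μ).card : ℝ) = (d : ℝ) - 1 := by
    rw [Finset.card_erase_of_mem (Finset.mem_univ μ), Finset.card_univ, Fintype.card_fin, Nat.cast_sub, Nat.cast_one]
    exact Fin.pos μ
  have h2 : ∀ ν, (∑ ε : Bool, a ν ε) ^ 2 ≤ 2 * ∑ ε : Bool, a ν ε ^ 2 := fun ν => by
    have h := sq_sum_le_card_mul_sum_sq (s := (Finset.univ : Finset Bool)) (f := fun ε => a ν ε)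
    simpa [Fintype.card_bool] using h
  rw [hcard] at h1
  have hd : (0 : ℝ) ≤ (d : ℝ) - 1 := by
    have : (1 : ℝ) ≤ d := by exact_mod_cast Fin.pos μ
    linarith
  calc (∑ ν ∈ Finset.univ.erase μ, ∑ ε : Bool, a ν ε) ^ 2
      ≤ ((d : ℝ) - 1) * ∑ ν ∈ Finset.univ.erase μ, (∑ ε : Bool, a ν ε) ^ 2 := h1
    _ ≤ ((d : ℝ) - 1) * ∑ ν ∈ Finset.univ.erase μ, (2 * ∑ ε : Bool, a ν ε ^ 2) := by
        gcongr with ν _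
        exact h2 ν
    _ = 2 * ((d : ℝ) - 1) * ∑ ν ∈ Finset.univ.erase μ, ∑ ε : Bool, a ν ε ^ 2 := by
        rw [← Finset.mul_sum]; ring

/-- ★★ **The gradient term is controlled by the plaquette costs**: for unitary `ρ`,
`‖M − Mᴴ‖²/2 ≤ 8(d−1)·Σ_{ν≠μ,ε} (N − Re tr ρ(hol P̃_{ν,ε}))`, `M = plaqSum`. [folklore] -/
theorem norm_sq_plaqSum_sub_star_le (hρ : ∀ g, ρ g ∈ Matrix.unitaryGroup (Fin N) ℂ) (x : Site d L) (μ : Fin d)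
    (U : GaugeConfig d L G) :
    ‖plaqSum ρ x μ U - star (plaqSum ρ x μ U)‖ ^ 2 / 2 ≤
      8 * ((d : ℝ) - 1) * ∑ ν ∈ Finset.univ.erase μ, ∑ ε : Bool,
        ((N : ℝ) - (ρ (wordHolonomy U x (plaqWord μ ν ε))).trace.re) := by
  -- `‖A‖ ≤ 2 Σ ‖1 − V‖`
  have hA : ‖plaqSum ρ x μ U - star (plaqSum ρ x μ U)‖ ≤
      ∑ ν ∈ Finset.univ.erase μ, ∑ ε : Bool, 2 * ‖(1 : Matrix (Fin N) (Fin N) ℂ) - ρ (wordHolonomy U x (plaqWord μ ν ε))‖ := by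
    rw [plaqSum, star_sum, ← Finset.sum_sub_distrib]
    refine (norm_sum_le _ _).trans (Finset.sum_le_sum fun ν _ => ?_)
    rw [star_sum, ← Finset.sum_sub_distrib]
    exact (norm_sum_le _ _).trans (Finset.sum_le_sum fun ε _ => norm_sub_star_le _)
  -- `‖1 − V‖² = 2 (N − Re tr V)`
  have hcost : ∀ ν ε, ‖(1 : Matrix (Fin N) (Fin N) ℂ) - ρ (wordHolonomy U x (plaqWord μ ν ε))‖ ^ 2 =
      2 * ((N : ℝ) - (ρ (wordHolonomy U x (plaqWord μ ν ε))).trace.re) := fun ν ε => by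
    have h := UnitaryCayley.re_trace_one_sub (hρ (wordHolonomy U x (plaqWord μ ν ε)))
    rw [Matrix.trace_sub, Matrix.trace_one, Complex.sub_re, Fintype.card_fin, Complex.natCast_re] at h
    linarith
  have h0 := norm_nonneg (plaqSum ρ x μ U - star (plaqSum ρ x μ U))
  have hsq : ‖plaqSum ρ x μ U - star (plaqSum ρ x μ U)‖ ^ 2 ≤
      (∑ ν ∈ Finset.univ.erase μ, ∑ ε : Bool, 2 * ‖(1 : Matrix (Fin N) (Fin N) ℂ) - ρ (wordHolonomy U x (plaqWord μ ν ε))‖) ^ 2 :=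
    pow_le_pow_left₀ h0 hA 2
  have hcs := sq_sum_sum_le μ (fun ν ε => 2 * ‖(1 : Matrix (Fin N) (Fin N) ℂ) - ρ (wordHolonomy U x (plaqWord μ ν ε))‖)
  have hrw : ∑ ν ∈ Finset.univ.erase μ, ∑ ε : Bool,
      (2 * ‖(1 : Matrix (Fin N) (Fin N) ℂ) - ρ (wordHolonomy U x (plaqWord μ ν ε))‖) ^ 2 =
      8 * ∑ ν ∈ Finset.univ.erase μ, ∑ ε : Bool, ((N : ℝ) - (ρ (wordHolonomy U x (plaqWord μ ν ε))).trace.re) := by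
    rw [Finset.mul_sum]
    refine Finset.sum_congr rfl fun ν _ => ?_
    rw [Finset.mul_sum]
    refine Finset.sum_congr rfl fun ε _ => ?_
    rw [mul_pow, hcost]; ring
  rw [hrw] at hcs
  have hd : (0 : ℝ) ≤ (d : ℝ) - 1 := by
    have : (1 : ℝ) ≤ d := by exact_mod_cast Fin.pos μ
    linarith
  nlinarith [hsq, hcs]

end Algebra

/-! ## Every plaquette word through the edge has the expectation of the mean plaquette -/

section Plaquettes

/-- The `+`-oriented word is the tree's plaquette: `Re tr ρ(hol P̃_{ν,+}) = N·u_P(x; μ, ν)`. [folklore] -/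
theorem re_trace_plaqWord_true (hN : N ≠ 0) (U : GaugeConfig d L G) (x : Site d L) (μ ν : Fin d) :
    (ρ (wordHolonomy U x (plaqWord μ ν true))).trace.re = N * plaquetteTrace ρ x μ ν U := by
  rw [plaqWord_true, wordHolonomy_plaquette, plaquetteTrace, ← mul_assoc,
    mul_inv_cancel₀ (by exact_mod_cast hN : (N : ℝ) ≠ 0), one_mul]

/-- The `−`-oriented word through `(y + e_ν, μ)` is a conjugate of the INVERSE of the plaquette at `y`:
`hol_{y+e_ν}(+μ −ν −μ +ν) = U(y,ν)⁻¹ · U_{y;μν}⁻¹ · U(y,ν)`. [folklore] -/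
theorem wordHolonomy_plaqWord_false (U : GaugeConfig d L G) (y : Site d L) (μ ν : Fin d) :
    wordHolonomy U (y.shift ν) (plaqWord μ ν false) =
      (U (y, ν))⁻¹ * (plaquetteHolonomy U y μ ν)⁻¹ * U (y, ν) := by
  have h1 : (y.shift ν).shift μ - Pi.single ν 1 = y.shift μ := shift_shift_sub y ν μ
  have h2 : y.shift μ - Pi.single μ 1 = y := shift_sub y μ
  simp only [plaqWord_false, wordHolonomy_cons, wordHolonomy_nil, stepHolonomy_fwd, stepHolonomy_bwd, Step.apply_fwd,
    Step.apply_bwd, h1, h2, plaquetteHolonomy, mul_inv_rev, inv_inv, mul_one, mul_assoc, inv_mul_cancel_left]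

/-- `Re tr ρ(hol P̃_{ν,−}) = N·u_P(x − e_ν; μ, ν)` (unitary `ρ`: the trace is a class function and
`Re tr ρ(g⁻¹) = Re tr ρ(g)`). [folklore] -/
theorem re_trace_plaqWord_false (hρ : ∀ g, ρ g ∈ Matrix.unitaryGroup (Fin N) ℂ) (hN : N ≠ 0) (U : GaugeConfig d L G)
    (x : Site d L) (μ ν : Fin d) :
    (ρ (wordHolonomy U x (plaqWord μ ν false))).trace.re = N * plaquetteTrace ρ (x - Pi.single ν 1) μ ν U := by
  set y := x - Pi.single ν 1 with hy
  have hx : x = y.shift ν := by rw [hy, Site.shift, sub_add_cancel]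
  -- `ρ(P⁻¹) = ρ(P)ᴴ` for the unitary-valued `ρ`
  have hinv : ρ (plaquetteHolonomy U y μ ν)⁻¹ = star (ρ (plaquetteHolonomy U y μ ν)) := by
    set g := plaquetteHolonomy U y μ ν
    have hu : ρ g * star (ρ g) = 1 := Matrix.mem_unitaryGroup_iff.1 (hρ g)
    have h1 : ρ g⁻¹ * ρ g = 1 := by rw [← map_mul, inv_mul_cancel, map_one]
    calc ρ g⁻¹ = ρ g⁻¹ * (ρ g * star (ρ g)) := by rw [hu, mul_one]
      _ = star (ρ g) := by rw [← mul_assoc, h1, one_mul]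
  rw [hx, wordHolonomy_plaqWord_false, map_mul, map_mul, Matrix.trace_mul_cycle, ← map_mul, mul_inv_cancel, map_one,
    Matrix.one_mul, hinv, Matrix.star_eq_conjTranspose, Matrix.trace_conjTranspose, Complex.star_def,
    Complex.conj_re, plaquetteTrace, ← mul_assoc, mul_inv_cancel₀ (by exact_mod_cast hN : (N : ℝ) ≠ 0), one_mul]

end Plaquettes

end Equipartition

end Summit.QuantumFields.GaugeBoot

end
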